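import Mathlib

/-!
# Fixed points commute with localisation at an invariant element (V4U, `HP₁` ingredient (G1))

(crux stmt-ResolutionOfSingularities-15640 `WildQuotients.WildQuotientResolution`, line `Sketch`,
sector `|G| = p`; programme V4U of `L/w45c/CHAIN.md` v7.3 §4, RULING v7.1 — ingredient
«invariants commute with localisation at the invariant `Q`» of the `μ₂` CONE BRICK `HP₁` of
`JordanFour.jordanFour_hasResolution_of_bricks` (lead-1 p501160); ORDER (G1) of res-L1-w45c-plan-1,
2026-08-27T06:01:46Z, signatures copied literally from `L/res-L1-w45c-plan-1/sig/G1Sig.lean`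
(sha16 0f2d89f431a1b9b1). [OURS · L1 W4.5c] — NOT a statement of any manuscript; replaces the role
of no printed item. Prover res-type-087.)

Generic, definition-free localisation algebra (Mathlib only). Throughout `R` is a domain,
`q ≠ 0`, `S` is any model of `R[1/q]` (`IsLocalization.Away q S`), `τ` is a ring (or `k`-algebra)
endomorphism of `R` with `τ q = q`, and `τS` an endomorphism of `S` over `τ`
(`τS ∘ algebraMap = algebraMap ∘ τ`; for `S = R[1/q]` this is the unique extension of `τ`).

* `isFixedPt_away_iff` (G1a) — `x ∈ S` is `τS`-fixed iff `x · qⁿ = f` for some `τ`-fixed `f ∈ R`.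
* `fixedPoints_away_eq_adjoin` (G1b) — `S^{τS} = k[R^τ, 1/q]`.
* `fixedPoints_adjoin_away_eq` (G1c) — relative to generating sets: if `q ∈ E := k[G₀]` and
  `E^τ = k[F₀]` (the shape of stub-1's p501651 `translate_fixedPoints_inter_even_eq`, `G₀ = evenGens`),
  then `(k[G₀, 1/q])^{τS} = k[F₀, 1/q]` inside `S` (the left adjoin is stub-2's `E_Q` of T2(b)).
* `exists_ringEquiv_away_adjoin` (G1d) — for a subalgebra `F ∋ q` of `R`, `k[F, 1/q] ⊆ S` is ring-
  isomorphic to `Localization.Away (q : F)` compatibly with `F`, so regularity of blow-ups transfers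
  (stub-4 (β) `ConeVertex.isRegular_affineBlowup_map_of_isLocalization_away`, p500272
  `Half111.blowup_regular`).

Supporting lemmas: `map_invSelf_of_map_algebraMap` (`τS (1/q) = 1/q`),
`eq_mul_invSelf_pow_of_mul_pow_eq` (`x · qⁿ = f ⇒ x = f · (1/q)ⁿ`),
`isFixedPt_of_mul_pow_eq` (the «if» half of (G1a), no domain hypothesis),
`algebraMap_mem_adjoin_away`, `exists_of_mem_adjoin_away` (every element of `k[G, 1/q]` is
`e · (1/q)ⁿ` with `e ∈ k[G]`, provided `q ∈ k[G]`).
-/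

-- single-problem summit: the doubled namespace component `ResolutionOfSingularities` is forced
set_option linter.dupNamespace false

namespace Summit.ResolutionOfSingularities.ResolutionOfSingularities.Theorems.WildQuotientResolution.BlowupExitAway

open IsLocalization

/-! ## Elementwise lemmas (ring endomorphisms) -/

section Ring

variable {R S : Type*} [CommRing R] [CommRing S] [Algebra R S]

/-- A ring endomorphism `τS` of `S = R[1/q]` (any `RingHomClass` map, e.g. a `k`-algebra map)
fixing the image of `q` fixes `1/q` (`IsLocalization.Away.invSelf q`): both are inverses of
`algebraMap R S q`. -/
theorem map_invSelf_of_map_algebraMap (q : R) [IsLocalization.Away q S] {FS : Type*}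
    [FunLike FS S S] [RingHomClass FS S S] (τS : FS)
    (h : τS (algebraMap R S q) = algebraMap R S q) :
    τS (IsLocalization.Away.invSelf (S := S) q) = IsLocalization.Away.invSelf (S := S) q := by
  have h1 : IsLocalization.Away.invSelf (S := S) q * algebraMap R S q = 1 := by
    rw [mul_comm]; exact IsLocalization.Away.mul_invSelf q
  have h2 : algebraMap R S q * τS (IsLocalization.Away.invSelf (S := S) q) = 1 := by
    rw [← h, ← map_mul, IsLocalization.Away.mul_invSelf, map_one]
  exact (left_inv_eq_right_inv h1 h2).symm

/-- In `S = R[1/q]`: if `x · qⁿ = f` then `x = f · (1/q)ⁿ`. -/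
theorem eq_mul_invSelf_pow_of_mul_pow_eq (q : R) [IsLocalization.Away q S] {x : S} {f : R} {n : ℕ}
    (hx : x * algebraMap R S q ^ n = algebraMap R S f) :
    x = algebraMap R S f * IsLocalization.Away.invSelf (S := S) q ^ n := by
  rw [← hx, mul_assoc, ← mul_pow, IsLocalization.Away.mul_invSelf, one_pow, mul_one]

/-- The «if» half of (G1a), valid for any commutative ring `R`: if `x · qⁿ = f` in `S = R[1/q]`
with `τ f = f` (and `τ q = q`), then `τS x = x` — `qⁿ` is a unit of `S`. (`τ`, `τS` any
`RingHomClass` maps, e.g. ring or `k`-algebra endomorphisms.) -/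
theorem isFixedPt_of_mul_pow_eq (q : R) [IsLocalization.Away q S] {FR FS : Type*}
    [FunLike FR R R] [RingHomClass FR R R] [FunLike FS S S] [RingHomClass FS S S]
    (τ : FR) (hτq : τ q = q) (τS : FS) (hτS : ∀ r, τS (algebraMap R S r) = algebraMap R S (τ r))
    {x : S} {f : R} {n : ℕ} (hf : τ f = f) (hx : x * algebraMap R S q ^ n = algebraMap R S f) :
    τS x = x := by
  have h := congrArg (τS : S → S) hx
  rw [map_mul, map_pow, hτS q, hτq, hτS f, hf, ← hx] at h
  exact (IsLocalization.Away.algebraMap_pow_isUnit (S := S) q n).mul_right_cancel h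

variable [IsDomain R]

/-- For a domain `R` and `q ≠ 0`, `algebraMap R S : R → R[1/q]` is injective. -/
theorem algebraMap_injective_of_away (q : R) (hq : q ≠ 0) [IsLocalization.Away q S] :
    Function.Injective (algebraMap R S) :=
  IsLocalization.injective S (powers_le_nonZeroDivisors_of_noZeroDivisors hq)

/-- If `x · qⁿ = e` in `S = R[1/q]` (`R` a domain, `q ≠ 0`, `τ q = q`) and `τS x = x`, then
`τ e = e`. (`τ`, `τS` any `RingHomClass` maps.) -/
theorem map_eq_self_of_mul_pow_eq (q : R) (hq : q ≠ 0) [IsLocalization.Away q S] {FR FS : Type*}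
    [FunLike FR R R] [RingHomClass FR R R] [FunLike FS S S] [RingHomClass FS S S]
    (τ : FR) (hτq : τ q = q) (τS : FS) (hτS : ∀ r, τS (algebraMap R S r) = algebraMap R S (τ r))
    {x : S} (hx : τS x = x) {e : R} {n : ℕ} (he : x * algebraMap R S q ^ n = algebraMap R S e) :
    τ e = e := by
  apply algebraMap_injective_of_away (S := S) q hq
  rw [← hτS e, ← he, map_mul, map_pow, hτS q, hτq, hx]

/-- **(G1a)** elementwise: for a domain `R`, `q ≠ 0`, `S = R[1/q]`, a ring endomorphism `τ` of `R`
with `τ q = q` and its (unique) extension `τS` to `S`: `x ∈ S` is `τS`-fixed iff `x = f / qⁿ` with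
`τ f = f`. [OURS · ORDER (G1) sig, literal] -/
theorem isFixedPt_away_iff {R S : Type*} [CommRing R] [IsDomain R] [CommRing S] [Algebra R S]
    (q : R) (hq : q ≠ 0) [IsLocalization.Away q S] (τ : R →+* R) (hτq : τ q = q)
    (τS : S →+* S) (hτS : ∀ r, τS (algebraMap R S r) = algebraMap R S (τ r)) (x : S) :
    τS x = x ↔ ∃ (f : R) (n : ℕ), τ f = f ∧ x * algebraMap R S q ^ n = algebraMap R S f := by
  constructor
  · intro hx
    obtain ⟨n, f, hf⟩ := IsLocalization.Away.surj q x
    exact ⟨f, n, map_eq_self_of_mul_pow_eq q hq τ hτq τS hτS hx hf, hf⟩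
  · rintro ⟨f, n, hf, hx⟩
    exact isFixedPt_of_mul_pow_eq q τ hτq τS hτS hf hx

end Ring

/-! ## Subalgebra-level lemmas (`k`-algebra endomorphisms) -/

section Algebra

variable {k R S : Type*} [CommRing k] [CommRing R] [CommRing S]
  [Algebra k R] [Algebra k S] [Algebra R S] [IsScalarTower k R S]

/-- `k[G] ⊆ R` maps into `k[algebraMap '' G, 1/q] ⊆ S`. -/
theorem algebraMap_mem_adjoin_away (q : R) [IsLocalization.Away q S] {G : Set R} {e : R}
    (he : e ∈ Algebra.adjoin k G) :
    algebraMap R S e ∈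
      Algebra.adjoin k (algebraMap R S '' G ∪ {IsLocalization.Away.invSelf (S := S) q}) := by
  have hmap : (Algebra.adjoin k G).map (IsScalarTower.toAlgHom k R S) ≤
      Algebra.adjoin k (algebraMap R S '' G ∪ {IsLocalization.Away.invSelf (S := S) q}) := by
    rw [AlgHom.map_adjoin, IsScalarTower.coe_toAlgHom']
    exact Algebra.adjoin_mono Set.subset_union_left
  exact hmap (Subalgebra.mem_map.mpr ⟨e, he, rfl⟩)

/-- Structure of `k[algebraMap '' G, 1/q] ⊆ S = R[1/q]` when `q ∈ k[G]`: every element is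
`e · (1/q)ⁿ`, i.e. `x · qⁿ = e`, with `e ∈ k[G]`. -/
theorem exists_of_mem_adjoin_away (q : R) [IsLocalization.Away q S] (G : Set R)
    (hqG : q ∈ Algebra.adjoin k G) {x : S}
    (hx : x ∈ Algebra.adjoin k (algebraMap R S '' G ∪ {IsLocalization.Away.invSelf (S := S) q})) :
    ∃ e ∈ Algebra.adjoin k G, ∃ n : ℕ, x * algebraMap R S q ^ n = algebraMap R S e := by
  induction hx using Algebra.adjoin_induction with
  | mem x hx =>
    rcases hx with ⟨g, hg, rfl⟩ | hx
    · exact ⟨g, Algebra.subset_adjoin hg, 0, by simp⟩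
    · rw [Set.mem_singleton_iff] at hx
      subst hx
      refine ⟨1, Subalgebra.one_mem _, 1, ?_⟩
      rw [pow_one, mul_comm, IsLocalization.Away.mul_invSelf, map_one]
  | algebraMap r =>
    refine ⟨algebraMap k R r, Subalgebra.algebraMap_mem _ r, 0, ?_⟩
    rw [pow_zero, mul_one, ← IsScalarTower.algebraMap_apply]
  | add x y _ _ ihx ihy =>
    obtain ⟨e₁, he₁, n₁, h₁⟩ := ihx
    obtain ⟨e₂, he₂, n₂, h₂⟩ := ihy
    refine ⟨e₁ * q ^ n₂ + e₂ * q ^ n₁, ?_, n₁ + n₂, ?_⟩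
    · exact Subalgebra.add_mem _ (Subalgebra.mul_mem _ he₁ (Subalgebra.pow_mem _ hqG _))
        (Subalgebra.mul_mem _ he₂ (Subalgebra.pow_mem _ hqG _))
    · rw [map_add, map_mul, map_mul, map_pow, map_pow, ← h₁, ← h₂, add_mul, pow_add]
      ring
  | mul x y _ _ ihx ihy =>
    obtain ⟨e₁, he₁, n₁, h₁⟩ := ihx
    obtain ⟨e₂, he₂, n₂, h₂⟩ := ihy
    refine ⟨e₁ * e₂, Subalgebra.mul_mem _ he₁ he₂, n₁ + n₂, ?_⟩
    rw [map_mul, ← h₁, ← h₂, pow_add]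
    ring

/-- **(G1b)** subalgebra form over a base ring `k` (`τ` a `k`-algebra map): the `τS`-fixed
elements of `S = R[1/q]` are exactly `k[ fixed elements of R, 1/q ]`.
[OURS · ORDER (G1) sig, literal] -/
theorem fixedPoints_away_eq_adjoin {k R S : Type*} [CommRing k] [CommRing R] [IsDomain R]
    [CommRing S] [Algebra k R] [Algebra k S] [Algebra R S] [IsScalarTower k R S]
    (q : R) (hq : q ≠ 0) [IsLocalization.Away q S] (τ : R →ₐ[k] R) (hτq : τ q = q)
    (τS : S →ₐ[k] S) (hτS : ∀ r, τS (algebraMap R S r) = algebraMap R S (τ r)) :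
    {x : S | τS x = x} = ↑(Algebra.adjoin k (algebraMap R S '' {f : R | τ f = f} ∪
      {IsLocalization.Away.invSelf (S := S) q})) := by
  refine Set.Subset.antisymm ?_ ?_
  · intro x hx
    obtain ⟨n, f, hx'⟩ := IsLocalization.Away.surj q x
    have hf : f ∈ {f : R | τ f = f} := map_eq_self_of_mul_pow_eq q hq τ hτq τS hτS hx hx'
    rw [SetLike.mem_coe, eq_mul_invSelf_pow_of_mul_pow_eq q hx']
    have h1 : algebraMap R S f ∈ Algebra.adjoin k (algebraMap R S '' {f : R | τ f = f} ∪
        {IsLocalization.Away.invSelf (S := S) q}) :=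
      Algebra.subset_adjoin (Set.mem_union_left _ (Set.mem_image_of_mem _ hf))
    have h2 : IsLocalization.Away.invSelf (S := S) q ∈ Algebra.adjoin k
        (algebraMap R S '' {f : R | τ f = f} ∪ {IsLocalization.Away.invSelf (S := S) q}) :=
      Algebra.subset_adjoin (Set.mem_union_right _ (Set.mem_singleton _))
    exact Subalgebra.mul_mem _ h1 (Subalgebra.pow_mem _ h2 n)
  · have hle : Algebra.adjoin k (algebraMap R S '' {f : R | τ f = f} ∪
        {IsLocalization.Away.invSelf (S := S) q}) ≤ AlgHom.equalizer τS (AlgHom.id k S) := by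
      refine Algebra.adjoin_le ?_
      rintro _ (⟨f, hf, rfl⟩ | h)
      · rw [Set.mem_setOf_eq] at hf
        rw [SetLike.mem_coe, AlgHom.mem_equalizer, AlgHom.id_apply, hτS, hf]
      · rw [Set.mem_singleton_iff] at h
        subst h
        rw [SetLike.mem_coe, AlgHom.mem_equalizer, AlgHom.id_apply]
        exact map_invSelf_of_map_algebraMap q τS (by rw [hτS, hτq])
    intro x hx
    have hx' := hle hx
    rw [AlgHom.mem_equalizer, AlgHom.id_apply] at hx'
    exact hx'

/-- **(G1c)** the fixed ring relative to a generating set: if `E = Algebra.adjoin k G₀ ⊆ R`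
contains `q` and one only knows that the fixed ring of `τ` on `E` is `Algebra.adjoin k F₀`
(stub-1 p501651 shape), then inside `S = R[1/q]`:
`{x ∈ k[algebraMap '' G₀, 1/q] | τS x = x} = k[algebraMap '' F₀, 1/q]`.
[OURS · ORDER (G1) sig, literal] -/
theorem fixedPoints_adjoin_away_eq {k R S : Type*} [Field k] [CommRing R] [IsDomain R] [CommRing S]
    [Algebra k R] [Algebra k S] [Algebra R S] [IsScalarTower k R S]
    (q : R) (hq : q ≠ 0) [IsLocalization.Away q S] (τ : R →ₐ[k] R) (hτq : τ q = q)
    (τS : S →ₐ[k] S) (hτS : ∀ r, τS (algebraMap R S r) = algebraMap R S (τ r))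
    (G₀ F₀ : Set R) (hqE : q ∈ Algebra.adjoin k G₀)
    (hfix : {f : R | f ∈ Algebra.adjoin k G₀ ∧ τ f = f} = ↑(Algebra.adjoin k F₀)) :
    {x : S | x ∈ Algebra.adjoin k (algebraMap R S '' G₀ ∪ {IsLocalization.Away.invSelf (S := S) q}) ∧
        τS x = x} =
      ↑(Algebra.adjoin k (algebraMap R S '' F₀ ∪ {IsLocalization.Away.invSelf (S := S) q})) := by
  refine Set.Subset.antisymm ?_ ?_
  · rintro x ⟨hxE, hx⟩
    obtain ⟨e, he, n, hn⟩ := exists_of_mem_adjoin_away q G₀ hqE hxE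
    have hτe : τ e = e := map_eq_self_of_mul_pow_eq q hq τ hτq τS hτS hx hn
    have heF : e ∈ (↑(Algebra.adjoin k F₀) : Set R) := by
      rw [← hfix]
      exact ⟨he, hτe⟩
    rw [SetLike.mem_coe, eq_mul_invSelf_pow_of_mul_pow_eq q hn]
    have h2 : IsLocalization.Away.invSelf (S := S) q ∈
        Algebra.adjoin k (algebraMap R S '' F₀ ∪ {IsLocalization.Away.invSelf (S := S) q}) :=
      Algebra.subset_adjoin (Set.mem_union_right _ (Set.mem_singleton _))
    exact Subalgebra.mul_mem _ (algebraMap_mem_adjoin_away q heF) (Subalgebra.pow_mem _ h2 n)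
  · have hF₀ : ∀ f ∈ F₀, f ∈ Algebra.adjoin k G₀ ∧ τ f = f := by
      intro f hf
      have h : f ∈ (↑(Algebra.adjoin k F₀) : Set R) := Algebra.subset_adjoin hf
      rw [← hfix] at h
      exact h
    have hle : Algebra.adjoin k (algebraMap R S '' F₀ ∪ {IsLocalization.Away.invSelf (S := S) q}) ≤
        Algebra.adjoin k (algebraMap R S '' G₀ ∪ {IsLocalization.Away.invSelf (S := S) q}) ⊓
          AlgHom.equalizer τS (AlgHom.id k S) := by
      refine Algebra.adjoin_le ?_
      rintro _ (⟨f, hf, rfl⟩ | h)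
      · obtain ⟨hfG, hτf⟩ := hF₀ f hf
        rw [SetLike.mem_coe, Algebra.mem_inf, AlgHom.mem_equalizer, AlgHom.id_apply, hτS, hτf]
        exact ⟨algebraMap_mem_adjoin_away q hfG, rfl⟩
      · rw [Set.mem_singleton_iff] at h
        subst h
        rw [SetLike.mem_coe, Algebra.mem_inf, AlgHom.mem_equalizer, AlgHom.id_apply]
        exact ⟨Algebra.subset_adjoin (Set.mem_union_right _ (Set.mem_singleton _)),
          map_invSelf_of_map_algebraMap q τS (by rw [hτS, hτq])⟩
    intro x hx
    have hx' := hle hx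
    rw [Algebra.mem_inf, AlgHom.mem_equalizer, AlgHom.id_apply] at hx'
    exact hx'

/-- **(G1d)** the subalgebra `k[F, 1/q] ⊆ S = R[1/q]` generated by a subalgebra `F ∋ q` of the
domain `R` and `1/q` IS (isomorphic to) the localisation of `F` at `q` — definition-free statement:
a ring isomorphism fixing `F` (so blow-ups / regularity transfer along it: stub-4 (β) applies to
`Localization.Away`). [OURS · ORDER (G1) sig, literal] -/
theorem exists_ringEquiv_away_adjoin {k R S : Type*} [Field k] [CommRing R] [IsDomain R] [CommRing S]
    [Algebra k R] [Algebra k S] [Algebra R S] [IsScalarTower k R S]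
    (q : R) (hq : q ≠ 0) [IsLocalization.Away q S] (F : Subalgebra k R) (hqF : q ∈ F) :
    ∃ e : Localization.Away (⟨q, hqF⟩ : F) ≃+*
        ↥(Algebra.adjoin k (algebraMap R S '' (F : Set R) ∪ {IsLocalization.Away.invSelf (S := S) q})),
      ∀ f : F, (e (algebraMap F (Localization.Away (⟨q, hqF⟩ : F)) f) : S) = algebraMap R S (f : R) := by
  set A : Subalgebra k S :=
    Algebra.adjoin k (algebraMap R S '' (F : Set R) ∪ {IsLocalization.Away.invSelf (S := S) q})
    with hA
  have hmem : ∀ f : F, algebraMap R S (f : R) ∈ A := fun f =>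
    Algebra.subset_adjoin (Set.mem_union_left _ ⟨(f : R), f.2, rfl⟩)
  have hinv : IsLocalization.Away.invSelf (S := S) q ∈ A :=
    Algebra.subset_adjoin (Set.mem_union_right _ (Set.mem_singleton _))
  let φ : F →+* A := ((algebraMap R S).comp F.val.toRingHom).codRestrict A (fun f => hmem f)
  letI : Algebra F A := φ.toAlgebra
  have hφ : ∀ f : F, ((algebraMap F A f : A) : S) = algebraMap R S (f : R) := fun f => rfl
  haveI : IsLocalization.Away (⟨q, hqF⟩ : F) A := by
    refine IsLocalization.Away.mk _ ?_ ?_ ?_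
    · refine isUnit_iff_exists.mpr ⟨⟨_, hinv⟩, ?_, ?_⟩
      · exact Subtype.ext (by rw [Subalgebra.coe_mul, hφ, Subalgebra.coe_one]; exact IsLocalization.Away.mul_invSelf q)
      · exact Subtype.ext (by rw [Subalgebra.coe_mul, hφ, Subalgebra.coe_one, mul_comm]; exact IsLocalization.Away.mul_invSelf q)
    · intro s
      have hqG : q ∈ Algebra.adjoin k (F : Set R) := by rw [Algebra.adjoin_eq]; exact hqF
      obtain ⟨e, he, n, hn⟩ := exists_of_mem_adjoin_away q (F : Set R) hqG s.2
      rw [Algebra.adjoin_eq] at he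
      refine ⟨n, ⟨e, he⟩, Subtype.ext ?_⟩
      rw [Subalgebra.coe_mul, Subalgebra.coe_pow, hφ, hφ]
      exact hn
    · intro a b hab
      refine ⟨0, ?_⟩
      have h : algebraMap R S (a : R) = algebraMap R S (b : R) := by
        rw [← hφ a, ← hφ b, hab]
      rw [Subtype.ext (algebraMap_injective_of_away (S := S) q hq h)]
  refine ⟨(IsLocalization.algEquiv (Submonoid.powers (⟨q, hqF⟩ : F))
    (Localization.Away (⟨q, hqF⟩ : F)) A).toRingEquiv, fun f => ?_⟩
  rw [AlgEquiv.coe_ringEquiv, AlgEquiv.commutes]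
  exact hφ f

end Algebra

end Summit.ResolutionOfSingularities.ResolutionOfSingularities.Theorems.WildQuotientResolution.BlowupExitAway
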